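import Mathlib
import HarnessLib
import Literature.MathematicalPhysics.KineticTheory.HardSphereEulerProofs
import Literature.Analysis.FluidPDE.CollisionalTransfer
import Summits.AtomisticToContinuum.HydrodynamicLimit.Theorems.OneFlightGossipEngineKineticCurrentsWindowLDUniformWindowRenyiIsothermal

/-!
# Statics for the reduction of `stub_windowRenyi` to kinetic-window transport tightness (Prelim)

Helper file (registered helper `stub_windowRenyi_prelim`) of the shared research-level stub
`stub_windowRenyi` of the crux `KineticCurrentsWindowLDUniform` (stmt-AtomisticToContinuum-14662;
lines `local-gibbs-entropy-ledger`, `Sketch`, `sigma-uniform-equilibrium-transfer`), consumed by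
`…WindowRenyiOfTransport.lean` (`stub_windowRenyi_of_transport`).

Content: the MODULAR HAMILTONIAN of a local Gibbs law. On the hard-sphere domain the canonical local
Gibbs density is `ψ = Z⁻¹ exp H`, `H(z) = Σᵢ log(a(xᵢ) M_{1,θ₀(xᵢ),u₀(xᵢ)}(vᵢ))`, and expanding the
Maxwellian exponent, `H = Σᵢ g̃(xᵢ) + momentumObservable (u₀/θ₀) − energyObservable (1/θ₀)` with
`g̃ = log a − (d/2) log(2πθ₀) − ‖u₀‖²/(2θ₀)` (`momentumObservable J z = Σᵢ ⟪J(xᵢ), vᵢ⟫`,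
`energyObservable ϑ z = Σᵢ ϑ(xᵢ)‖vᵢ‖²/2` of `Literature.Analysis.FluidPDE.CollisionalTransfer`).
Hence the COCYCLE `ψ(z') = ψ(z)·exp(ΔG + ΔM_{u₀/θ₀} − ΔE_{1/θ₀})` between two points of the domain
(`stub_windowRenyi_prelim`): along an orbit, the Rényi integrand of the stub is the exponential of the
window change of ONE extensive observable. Also collected (adapted from the landed isothermal file,
whose helpers are private): the quadratic modulus of a continuous function on `𝕋³`, the
displacement–energy bound of position sums along good orbits, the choice of the Gaussian energy
exponent, the vanishing of the kinetic window, and positivity of `ψ` on the domain.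
-/

noncomputable section

open MeasureTheory Set Filter
open scoped ENNReal Topology InnerProductSpace

namespace Summit.AtomisticToContinuum.HydrodynamicLimit.Theorems.KineticCurrentsWindowLDUniformLocalGibbs

open Literature.Analysis.FluidPDE (HardSphereFlow Config localMaxwellian canonicalDensity liouville
  hardSphereDomain tensorPow energyObservable momentumObservable)
open Literature.MathematicalPhysics.KineticTheory (T3 V3 hsDiameter localGibbsLaw localGibbsMeasure
  localGibbsProfile)
open Literature.Analysis.FluidPDE Literature.MathematicalPhysics.KineticTheory

/-! ### Static helpers (adapted from the landed isothermal file, whose helpers are private) -/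

/-- Increments of a continuous function on `𝕋³` are uniformly small up to a quadratic penalty in the
minimal-image distance: for every `κ > 0` there is `C ≥ 0` with `g x − g y ≤ κ + C · dist_{𝕋³}(y, x)²`.
[folklore] -/
-- adapted from OneFlightGossipEngineKineticCurrentsWindowLDUniformWindowRenyiIsothermal.lean
theorem wre_sub_le_quad {g : T3 → ℝ} (hg : Continuous g) {κ : ℝ} (hκ : 0 < κ) :
    ∃ C : ℝ, 0 ≤ C ∧ ∀ x y : T3, g x - g y ≤ κ + C * Torus.euclidDist y x ^ 2 := by
  obtain ⟨B, hB0, hB⟩ := exists_forall_abs_le_of_continuous hg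
  obtain ⟨ℓ, hℓ, huc⟩ := Metric.uniformContinuous_iff.1
    (CompactSpace.uniformContinuous_of_continuous hg) κ hκ
  refine ⟨2 * B / ℓ ^ 2, by positivity, fun x y => ?_⟩
  have hnn : 0 ≤ 2 * B / ℓ ^ 2 * Torus.euclidDist y x ^ 2 := by positivity
  by_cases hd : Torus.euclidDist y x < ℓ
  · have hxy : dist x y < ℓ := by
      rw [dist_eq_norm]
      exact (Torus.norm_sub_le_euclidDist_holds x y).trans_lt (by rwa [Torus.euclidDist_comm])
    have h := huc hxy
    rw [Real.dist_eq] at h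
    linarith [(le_abs_self _).trans_lt h]
  · rw [not_lt] at hd
    have h1 : g x - g y ≤ 2 * B := by
      linarith [(abs_le.1 (hB x)).2, (abs_le.1 (hB y)).1]
    have h2 : 2 * B ≤ 2 * B / ℓ ^ 2 * Torus.euclidDist y x ^ 2 := by
      rw [div_mul_eq_mul_div, le_div_iff₀ (by positivity)]
      exact mul_le_mul_of_nonneg_left (pow_le_pow_left₀ hℓ.le hd 2) (by positivity)
    linarith

/-- **Position log-ratios along a good orbit are controlled by the conserved energy.** If
`g x − g y ≤ κ + C dist(y,x)²`, then over a window `[0, r]`,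
`Σᵢ (g(xᵢ(0)) − g(xᵢ(r))) ≤ n κ + C · 2 r² E(z)`. [folklore] -/
-- adapted from OneFlightGossipEngineKineticCurrentsWindowLDUniformWindowRenyiIsothermal.lean
theorem wre_sum_ratio_le {ε : ℝ} {n : ℕ}
    (Φ : HardSphereFlow (Torus.geometry (Fin 3)) ε n) {z : Config n (Fin 3) T3} (hz : z ∈ Φ.good)
    {g : T3 → ℝ} {κ C : ℝ} (hC : 0 ≤ C)
    (hg : ∀ x y : T3, g x - g y ≤ κ + C * Torus.euclidDist y x ^ 2) {r : ℝ} (hr : 0 ≤ r) :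
    ∑ i, (g (z i).1 - g (Φ.flow r z i).1) ≤ n * κ + C * (2 * r ^ 2 * configEnergy z) := by
  obtain ⟨hint2, hsum⟩ := sum_window_integral_norm_sq_eq Φ hz r
  have hγm : Measurable fun t => Φ.flow t z := (Φ.isTrajectory z hz).measurable_torus
  have hint1 : ∀ i, IntervalIntegrable (fun s => ‖(Φ.flow s z i).2‖) volume 0 r := fun i =>
    (intervalIntegrable_const (c := Real.sqrt (2 * configEnergy z))).mono_fun'
      ((measurable_pi_apply i).comp hγm).snd.norm.aestronglyMeasurable
      (ae_of_all _ fun s => by simpa only [norm_norm] using Φ.norm_vel_flow_le hz s i)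
  have hdi : ∀ i, Torus.euclidDist (Φ.flow r z i).1 (z i).1 ^ 2 ≤
      r * ∫ s in (0 : ℝ)..r, ‖(Φ.flow s z i).2‖ ^ 2 := fun i =>
    (pow_le_pow_left₀ (norm_nonneg _)
      (ShearStressHalfDrudeDisplacement.euclidDist_flow_le_integral_norm_vel Φ hz i hr) 2).trans
      (EquilibriumStressVarianceDecayC3.sq_integral_le_mul_integral_sq hr (hint1 i) (hint2 i))
  calc ∑ i, (g (z i).1 - g (Φ.flow r z i).1)
      ≤ ∑ i, (κ + C * (r * ∫ s in (0 : ℝ)..r, ‖(Φ.flow s z i).2‖ ^ 2)) :=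
        Finset.sum_le_sum fun i _ =>
          (hg _ _).trans (add_le_add le_rfl (mul_le_mul_of_nonneg_left (hdi i) hC))
    _ = n * κ + C * (2 * r ^ 2 * configEnergy z) := by
        rw [Finset.sum_add_distrib, Finset.sum_const, Finset.card_univ, Fintype.card_fin,
          nsmul_eq_mul, ← Finset.mul_sum, ← Finset.mul_sum, hsum]
        ring

/-- Choice of the energy exponent: for `δ > 0` there is `γ > 0` with `2γΘ < 1` and
`exp(γU²) (1 − 2γΘ)^{-3/2} ≤ exp δ`. [folklore] -/
-- adapted from OneFlightGossipEngineKineticCurrentsWindowLDUniformWindowRenyiIsothermal.lean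
theorem wre_exists_gamma {Θ δ : ℝ} (hΘ : 0 < Θ) (hδ : 0 < δ) (U : ℝ) :
    ∃ γ : ℝ, 0 < γ ∧ 2 * γ * Θ < 1 ∧
      Real.exp (γ * U ^ 2) * (1 - 2 * γ * Θ) ^ (-(3 : ℝ) / 2) ≤ Real.exp δ := by
  obtain ⟨γ, hγ0, hγ1, hγ2⟩ : ∃ γ : ℝ, 0 < γ ∧ γ * (4 * Θ) ≤ 1 ∧ γ * (U ^ 2 + 6 * Θ) ≤ δ :=
    ⟨min (1 / (4 * Θ)) (δ / (U ^ 2 + 6 * Θ)), lt_min (by positivity) (by positivity),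
      (le_div_iff₀ (by positivity)).1 (min_le_left _ _),
      (le_div_iff₀ (by positivity)).1 (min_le_right _ _)⟩
  have hx0 : 0 ≤ 2 * γ * Θ := by positivity
  have hx2 : 2 * γ * Θ ≤ 1 / 2 := by linarith
  have hk : 0 < 1 - 2 * γ * Θ := by linarith
  have h1 : (1 - 2 * γ * Θ)⁻¹ ≤ Real.exp (2 * (2 * γ * Θ)) := by
    rw [inv_le_iff_one_le_mul₀' hk]
    nlinarith [mul_nonneg hk.le (sub_nonneg.2 (Real.add_one_le_exp (2 * (2 * γ * Θ)))),
      mul_nonneg hx0 (sub_nonneg.2 hx2)]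
  refine ⟨γ, hγ0, by linarith, ?_⟩
  calc Real.exp (γ * U ^ 2) * (1 - 2 * γ * Θ) ^ (-(3 : ℝ) / 2)
      ≤ Real.exp (γ * U ^ 2) * Real.exp (2 * (2 * γ * Θ)) ^ ((3 : ℝ) / 2) := by
        rw [show (-(3 : ℝ) / 2) = -((3 : ℝ) / 2) by ring, Real.rpow_neg hk.le,
          ← Real.inv_rpow hk.le]
        exact mul_le_mul_of_nonneg_left
          (Real.rpow_le_rpow (inv_nonneg.2 hk.le) h1 (by norm_num)) (Real.exp_nonneg _)
    _ = Real.exp (γ * (U ^ 2 + 6 * Θ)) := by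
        rw [← Real.exp_mul, ← Real.exp_add]
        congr 1
        ring
    _ ≤ Real.exp δ := Real.exp_le_exp.2 hγ2

/-- The kinetic window `w_N = τ (N+1)^{-1/3}` tends to `0`, so `C · 4 w_N² < γ` eventually.
[folklore] -/
-- adapted from OneFlightGossipEngineKineticCurrentsWindowLDUniformWindowRenyiIsothermal.lean
theorem wre_exists_N0 (τ C : ℝ) {γ : ℝ} (hγ : 0 < γ) :
    ∃ N₀ : ℕ, ∀ N : ℕ, N₀ ≤ N → C * (4 * (τ * ((N : ℝ) + 1) ^ (-(1 / 3 : ℝ))) ^ 2) < γ := by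
  have h1 : Tendsto (fun N : ℕ => τ * ((N : ℝ) + 1) ^ (-(1 / 3 : ℝ))) atTop (𝓝 (τ * 0)) :=
    ((tendsto_rpow_neg_atTop (by norm_num : (0 : ℝ) < 1 / 3)).comp
      (tendsto_atTop_add_const_right atTop 1 tendsto_natCast_atTop_atTop)).const_mul τ
  have h2 : Tendsto (fun N : ℕ => C * (4 * (τ * ((N : ℝ) + 1) ^ (-(1 / 3 : ℝ))) ^ 2)) atTop
      (𝓝 (C * (4 * (τ * 0) ^ 2))) := ((h1.pow 2).const_mul 4).const_mul C
  rw [mul_zero, zero_pow two_ne_zero, mul_zero, mul_zero] at h2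
  exact eventually_atTop.1 (h2.eventually (gt_mem_nhds hγ))

/-- The canonical density of the local Gibbs profile is positive on the hard-sphere domain
(`a, θ₀ > 0` continuous, `σ ≤ 1/2`: the partition function is the positive position partition
function). [folklore] -/
-- adapted from OneFlightGossipEngineKineticCurrentsWindowLDUniformWindowTransferOfRenyi.lean
theorem wre_canonicalDensity_pos_of_mem {σ : ℝ} {a θ₀ : T3 → ℝ} {u₀ : T3 → V3}
    (ha : Continuous a) (hθ : Continuous θ₀) (hu : Continuous u₀)
    (ha0 : ∀ x, 0 < a x) (hθ0 : ∀ x, 0 < θ₀ x) (hσ2 : σ ≤ 1 / 2) {N : ℕ}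
    {z : Config (N + 1) (Fin 3) T3}
    (hz : z ∈ hardSphereDomain (Torus.geometry (Fin 3)) (N + 1) (hsDiameter σ N)) :
    0 < canonicalDensity (Torus.geometry (Fin 3)) (hsDiameter σ N) (N + 1)
      (localGibbsProfile a u₀ θ₀) z := by
  unfold canonicalDensity
  rw [Set.indicator_of_mem hz, canonicalPartition_eq_posPartition ha hθ hu (fun x => (ha0 x).le) hθ0]
  refine mul_pos (inv_pos.2 (posPartition_pos ha ha0 hσ2 N)) ?_
  exact Finset.prod_pos fun i _ => mul_pos (ha0 _) (localMaxwellian_pos one_pos (hθ0 _) _ _)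

/-! ### The modular Hamiltonian of a local Gibbs law -/

/-- **The local Gibbs profile is log-quadratic in the velocity**:
`log(a(x) M_{1,θ₀(x),u₀(x)}(v)) = g̃(x) + ⟪u₀(x)/θ₀(x), v⟫ − θ₀(x)⁻¹ ‖v‖²/2` with
`g̃ = log a − (d/2) log(2πθ₀) − ‖u₀‖²/(2θ₀)`. [folklore] -/
theorem wre_log_localGibbsProfile {a θ₀ : T3 → ℝ} {u₀ : T3 → V3}
    (ha0 : ∀ x, 0 < a x) (hθ0 : ∀ x, 0 < θ₀ x) (x : T3) (v : V3) :
    Real.log (localGibbsProfile a u₀ θ₀ (x, v)) =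
      (Real.log (a x) + (-(Module.finrank ℝ V3 : ℝ) / 2) * Real.log (2 * Real.pi * θ₀ x) -
          (θ₀ x)⁻¹ * ‖u₀ x‖ ^ 2 / 2) +
        ⟪(θ₀ x)⁻¹ • u₀ x, v⟫_ℝ - (θ₀ x)⁻¹ * (‖v‖ ^ 2 / 2) := by
  have h2 : 0 < 2 * Real.pi * θ₀ x := mul_pos (mul_pos two_pos Real.pi_pos) (hθ0 x)
  have hr : 0 < (2 * Real.pi * θ₀ x) ^ (-(Module.finrank ℝ V3 : ℝ) / 2) := Real.rpow_pos_of_pos h2 _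
  have he : 0 < Real.exp (-‖v - u₀ x‖ ^ 2 / (2 * θ₀ x)) := Real.exp_pos _
  simp only [localGibbsProfile, localMaxwellian, one_mul]
  rw [Real.log_mul (ha0 x).ne' (mul_pos hr he).ne', Real.log_mul hr.ne' he.ne', Real.log_exp,
    Real.log_rpow h2, norm_sub_sq_real, real_inner_smul_left, real_inner_comm]
  field_simp
  ring

/-- **The tensor power of the local Gibbs profile is the exponential of the modular Hamiltonian**
`H(z) = Σᵢ log(a(xᵢ) M_{xᵢ}(vᵢ))` (all factors are positive). [folklore] -/
theorem wre_tensorPow_eq_exp {a θ₀ : T3 → ℝ} {u₀ : T3 → V3}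
    (ha0 : ∀ x, 0 < a x) (hθ0 : ∀ x, 0 < θ₀ x) {n : ℕ} (z : Config n (Fin 3) T3) :
    tensorPow n (localGibbsProfile a u₀ θ₀) z =
      Real.exp (∑ i, Real.log (localGibbsProfile a u₀ θ₀ (z i))) := by
  simp only [tensorPow]
  rw [Real.exp_sum]
  exact Finset.prod_congr rfl fun i _ =>
    (Real.exp_log (mul_pos (ha0 _) (localMaxwellian_pos one_pos (hθ0 _) _ _))).symm

/-- **Cocycle of the canonical local Gibbs density on the hard-sphere domain**:
`ψ(z') = ψ(z) · exp(H(z') − H(z))` (the indicator and the partition function cancel). [folklore] -/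
theorem wre_canonicalDensity_cocycle {σ : ℝ} {a θ₀ : T3 → ℝ} {u₀ : T3 → V3}
    (ha0 : ∀ x, 0 < a x) (hθ0 : ∀ x, 0 < θ₀ x) {N : ℕ} {z z' : Config (N + 1) (Fin 3) T3}
    (hz : z ∈ hardSphereDomain (Torus.geometry (Fin 3)) (N + 1) (hsDiameter σ N))
    (hz' : z' ∈ hardSphereDomain (Torus.geometry (Fin 3)) (N + 1) (hsDiameter σ N)) :
    canonicalDensity (Torus.geometry (Fin 3)) (hsDiameter σ N) (N + 1) (localGibbsProfile a u₀ θ₀) z' =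
      canonicalDensity (Torus.geometry (Fin 3)) (hsDiameter σ N) (N + 1) (localGibbsProfile a u₀ θ₀) z *
        Real.exp ((∑ i, Real.log (localGibbsProfile a u₀ θ₀ (z' i))) -
          ∑ i, Real.log (localGibbsProfile a u₀ θ₀ (z i))) := by
  simp only [canonicalDensity]
  rw [indicator_of_mem hz', indicator_of_mem hz, wre_tensorPow_eq_exp ha0 hθ0 z',
    wre_tensorPow_eq_exp ha0 hθ0 z, Real.exp_sub, mul_div_assoc', eq_div_iff (Real.exp_pos _).ne']
  ring

/-- **The modular Hamiltonian splits into a position part, the tested momentum field and the tested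
kinetic-energy field**: `H(z) = Σᵢ g̃(xᵢ) + momentumObservable (u₀/θ₀) z − energyObservable (1/θ₀) z`.
[folklore] -/
theorem wre_modularHamiltonian_eq {a θ₀ : T3 → ℝ} {u₀ : T3 → V3}
    (ha0 : ∀ x, 0 < a x) (hθ0 : ∀ x, 0 < θ₀ x) {n : ℕ} (z : Config n (Fin 3) T3) :
    (∑ i, Real.log (localGibbsProfile a u₀ θ₀ (z i))) =
      (∑ i, (Real.log (a (z i).1) +
          (-(Module.finrank ℝ V3 : ℝ) / 2) * Real.log (2 * Real.pi * θ₀ (z i).1) -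
          (θ₀ (z i).1)⁻¹ * ‖u₀ (z i).1‖ ^ 2 / 2)) +
        momentumObservable (fun x => (θ₀ x)⁻¹ • u₀ x) z -
        energyObservable (fun x => (θ₀ x)⁻¹) z := by
  simp only [momentumObservable, energyObservable, ← Finset.sum_add_distrib, ← Finset.sum_sub_distrib]
  exact Finset.sum_congr rfl fun i _ => wre_log_localGibbsProfile ha0 hθ0 (z i).1 (z i).2


/-! ### The cocycle of the canonical local Gibbs density -/

/-- **Cocycle of the canonical local Gibbs density through its modular Hamiltonian (registered helper
`stub_windowRenyi_prelim` of the shared stub `stub_windowRenyi`).** For two configurations `z, z'` of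
the hard-sphere domain, `ψ(z') = ψ(z) · exp(ΔG + ΔM − ΔE)` where `G = Σᵢ g̃(xᵢ)`,
`g̃ = log a − (d/2) log(2πθ₀) − ‖u₀‖²/(2θ₀)`, `M = momentumObservable (u₀/θ₀)`,
`E = energyObservable (1/θ₀)`: the indicator and the partition function cancel, and the local
Maxwellian is log-quadratic in the velocity. Applied to `z' = Φ_r z` this turns the Rényi integrand
`(ψ∘Φ_{-r})^p ψ^{1-p}` into `ψ · exp((p-1)·(window decrease of G + M − E))`. [folklore] -/
theorem stub_windowRenyi_prelim :
    ∀ (a θ₀ : T3 → ℝ) (u₀ : T3 → V3), (∀ x, 0 < a x) → (∀ x, 0 < θ₀ x) → ∀ (σ : ℝ) (N : ℕ)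
      (z z' : Config (N + 1) (Fin 3) T3),
      z ∈ hardSphereDomain (Literature.Analysis.FluidPDE.Torus.geometry (Fin 3)) (N + 1) (hsDiameter σ N) →
      z' ∈ hardSphereDomain (Literature.Analysis.FluidPDE.Torus.geometry (Fin 3)) (N + 1) (hsDiameter σ N) →
      canonicalDensity (Literature.Analysis.FluidPDE.Torus.geometry (Fin 3)) (hsDiameter σ N) (N + 1)
          (localGibbsProfile a u₀ θ₀) z' =
        canonicalDensity (Literature.Analysis.FluidPDE.Torus.geometry (Fin 3)) (hsDiameter σ N) (N + 1)
            (localGibbsProfile a u₀ θ₀) z *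
          Real.exp (((∑ i, (Real.log (a (z' i).1) +
                (-(Module.finrank ℝ V3 : ℝ) / 2) * Real.log (2 * Real.pi * θ₀ (z' i).1) -
                (θ₀ (z' i).1)⁻¹ * ‖u₀ (z' i).1‖ ^ 2 / 2)) -
              ∑ i, (Real.log (a (z i).1) +
                (-(Module.finrank ℝ V3 : ℝ) / 2) * Real.log (2 * Real.pi * θ₀ (z i).1) -
                (θ₀ (z i).1)⁻¹ * ‖u₀ (z i).1‖ ^ 2 / 2)) +
            (momentumObservable (fun x => (θ₀ x)⁻¹ • u₀ x) z' -
              momentumObservable (fun x => (θ₀ x)⁻¹ • u₀ x) z) -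
            (energyObservable (fun x => (θ₀ x)⁻¹) z' - energyObservable (fun x => (θ₀ x)⁻¹) z)) := by
  intro a θ₀ u₀ ha0 hθ0 σ N z z' hz hz'
  rw [wre_canonicalDensity_cocycle ha0 hθ0 hz hz', wre_modularHamiltonian_eq ha0 hθ0 z',
    wre_modularHamiltonian_eq ha0 hθ0 z]
  congr 2
  ring

end Summit.AtomisticToContinuum.HydrodynamicLimit.Theorems.KineticCurrentsWindowLDUniformLocalGibbs

end
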